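import Literature.AlgebraicTopology.FundamentalGroup.CircleValuedWinding
import HarnessLib

/-!
# A loop crossing the fibre of a circle-valued map once has winding number `±1`

Topic `Literature/AlgebraicTopology/FundamentalGroup`; a proved complement to
`CircleValuedWinding.lean` (the winding homomorphism `π₁(X, x) → π₁(ℝ/ℤ, θ x) ≅ ℤ` of a
continuous `θ : X → ℝ/ℤ`, evaluated by real lifts: `wind_fromPath_eq_of_lift`).  It is the
elementary computation behind "the algebraic intersection number of a loop with a two-sided
hypersurface `P` which it crosses once, transversally, is `±1`", with `θ` the Pontryagin–Thom
collapse of a normal coordinate of `P` and `P = θ⁻¹(0)` (Hatcher, *Algebraic Topology* (2002),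
Thm. 1.7 and its proof; Milnor, *Topology from the differentiable viewpoint* (1965), §5: degree
modulo crossings).  Written as infrastructure for the `π₁`-obstruction to a non-separating
reducing curve of a trisection (`TrisectionFunctorGKPi1Obstruction.lean`: a character of `π₁` of
the central surface which is non-zero on a dual loop).

## What is proved (everything; no definitions, no named facts)

* `lift_one_eq_lift_zero_add_one` — **the real core.**  A continuous `Λ : [0, 1] → ℝ` which takes
  integer values only at one time `t₀`, where `Λ t₀ = 0`, which is positive somewhere after `t₀`
  and negative somewhere before `t₀`, and whose end values differ by an integer, satisfies
  `Λ 1 = Λ 0 + 1` (intermediate value theorem: `0 < Λ < 1` after `t₀`, `-1 < Λ < 0` before).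
  `lift_one_eq_lift_zero_sub_one` is the mirror image.
* `wind_eq_ofAdd_one_of_crossing`, `wind_eq_ofAdd_neg_one_of_crossing` — **the winding number
  of a single crossing.**  Let `θ : X → ℝ/ℤ` be continuous and `γ` a loop at `x` such that
  `θ (γ t) = 0` only for `t = t₀`, and such that near `t₀` the loop has a real lift `μ` of
  `θ ∘ γ` with `μ t₀ = 0`, positive after `t₀` and negative before (resp. the reverse).  Then the
  winding homomorphism takes the value `+1` (resp. `-1`) on `[γ]`.
* `wind_ne_one_of_crossing` — in either case the winding homomorphism is non-trivial on `[γ]`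
  (so `[γ] ≠ 1` in `π₁(X, x)` and the winding homomorphism is not the trivial homomorphism,
  `windingHom_ne_one_of_crossing`).

## References

* A. Hatcher, *Algebraic Topology*, CUP (2002), Thm. 1.7 (p. 29) and its proof, Prop. 1.30
  (uniqueness of lifts). [HatcherAT2002]
* J. Milnor, *Topology from the differentiable viewpoint*, Univ. Press of Virginia (1965), §5
  (the degree as a signed count of crossings).
-/

noncomputable section

open scoped unitInterval Topology
open Set Function Filter

namespace Literature.AlgebraicTopology.FundamentalGroup

/-! ### The real core: a lift crossing the integers once -/

section Real

/-- **Intermediate values along the unit interval, read through real parameters.**  If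
`f : [0, 1] → ℝ` is continuous and `a, b ∈ [0, 1]` then every value between `f a` and `f b` is
taken at some point of `[0, 1]` between `a` and `b`. [folklore] -/
theorem exists_mem_uIcc_apply_eq {f : I → ℝ} (hf : Continuous f) (a b : I) {y : ℝ}
    (hy : y ∈ uIcc (f a) (f b)) : ∃ c : I, (c : ℝ) ∈ uIcc (a : ℝ) b ∧ f c = y := by
  -- read `f` on the real line through the projection onto `[0, 1]`
  set g : ℝ → ℝ := f ∘ projIcc (0 : ℝ) 1 zero_le_one with hg
  have hgc : Continuous g := hf.comp continuous_projIcc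
  have hga : g a = f a := by simp [hg, projIcc_val]
  have hgb : g b = f b := by simp [hg, projIcc_val]
  have hy' : y ∈ uIcc (g a) (g b) := by rwa [hga, hgb]
  obtain ⟨c, hc, hcy⟩ := intermediate_value_uIcc hgc.continuousOn hy'
  refine ⟨projIcc 0 1 zero_le_one c, ?_, hcy⟩
  have hcI : c ∈ Icc (0 : ℝ) 1 := by
    rcases le_total (a : ℝ) b with hab | hab
    · rw [uIcc_of_le hab] at hc
      exact ⟨a.2.1.trans hc.1, hc.2.trans b.2.2⟩
    · rw [uIcc_of_ge hab] at hc
      exact ⟨b.2.1.trans hc.1, hc.2.trans a.2.2⟩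
  rwa [projIcc_of_mem _ hcI]

/-- **The real core of the crossing computation.**  Let `Λ : [0, 1] → ℝ` be continuous, with
`Λ t₀ = 0`, taking integer values at no time other than `t₀`, positive at some time after `t₀`
and negative at some time before `t₀`, and with `Λ 1 - Λ 0 ∈ ℤ`.  Then `Λ 1 = Λ 0 + 1`.
Proof: after `t₀` the function has no zero, so (intermediate value theorem from the positive
witness) it is positive, and it never reaches `1` (it is `< 1` right after `t₀`), so
`Λ 1 ∈ (0, 1)`; symmetrically `Λ 0 ∈ (-1, 0)`; the integer `Λ 1 - Λ 0 ∈ (0, 2)` is `1`.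
[cite: HatcherAT2002, Thm. 1.7 (p. 29) and its proof] -/
theorem lift_one_eq_lift_zero_add_one (Λ : I → ℝ) (hΛ : Continuous Λ) (t₀ : I) (h0 : Λ t₀ = 0)
    (hint : ∀ t : I, ∀ n : ℤ, Λ t = n → t = t₀)
    (hpos : ∃ t : I, t₀ < t ∧ 0 < Λ t) (hneg : ∃ t : I, t < t₀ ∧ Λ t < 0)
    (hends : ∃ n : ℤ, Λ 1 = Λ 0 + n) : Λ 1 = Λ 0 + 1 := by
  obtain ⟨a, hta, ha⟩ := hpos
  obtain ⟨b, htb, hb⟩ := hneg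
  -- no integer value is taken off `t₀`
  have hnoint : ∀ t : I, t ≠ t₀ → ∀ n : ℤ, Λ t ≠ n := fun t ht n h => ht (hint t n h)
  -- (1) after `t₀` the lift is positive
  have hafter_pos : ∀ t : I, t₀ < t → 0 < Λ t := by
    intro t ht
    by_contra hle
    push Not at hle
    -- a zero between `t` and `a`, both after `t₀`
    obtain ⟨c, hc, hc0⟩ := exists_mem_uIcc_apply_eq hΛ t a (y := 0) ⟨by
      rw [inf_le_iff]; exact Or.inl hle, by rw [le_sup_iff]; exact Or.inr ha.le⟩
    have hct₀ : t₀ < c := by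
      have h1 : min (t : ℝ) a ≤ c := hc.1
      have h2 : (t₀ : ℝ) < min (t : ℝ) a := lt_min (Subtype.coe_lt_coe.2 ht) (Subtype.coe_lt_coe.2 hta)
      exact Subtype.coe_lt_coe.1 (h2.trans_le h1)
    exact hnoint c hct₀.ne' 0 (by rw [hc0, Int.cast_zero])
  -- (2) after `t₀` the lift stays below `1`
  have hafter_lt : ∀ t : I, t₀ < t → Λ t < 1 := by
    -- a time right after `t₀` where `Λ < 1`
    obtain ⟨s, hts, hs⟩ : ∃ s : I, t₀ < s ∧ Λ s < 1 := by
      have hev : ∀ᶠ t in 𝓝 t₀, Λ t < 1 :=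
        hΛ.continuousAt.eventually (gt_mem_nhds (by rw [h0]; exact one_pos))
      have ht₀1 : (t₀ : ℝ) < 1 := (Subtype.coe_lt_coe.2 hta).trans_le a.2.2
      obtain ⟨ε, hε, hball⟩ := Metric.eventually_nhds_iff.1 hev
      set r : ℝ := min ((t₀ : ℝ) + ε / 2) 1 with hr
      have hrI : r ∈ Icc (0 : ℝ) 1 := ⟨le_min (t₀.2.1.trans (by linarith)) zero_le_one, min_le_right _ _⟩
      refine ⟨⟨r, hrI⟩, ?_, hball ?_⟩
      · change (t₀ : ℝ) < r
        exact lt_min (by linarith) ht₀1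
      · rw [Subtype.dist_eq, Real.dist_eq]
        change |r - (t₀ : ℝ)| < ε
        rw [abs_lt]
        constructor
        · have : (t₀ : ℝ) < r := lt_min (by linarith) ht₀1
          linarith
        · have : r ≤ (t₀ : ℝ) + ε / 2 := min_le_left _ _
          linarith
    intro t ht
    by_contra hge
    push Not at hge
    obtain ⟨c, hc, hc1⟩ := exists_mem_uIcc_apply_eq hΛ s t (y := 1) ⟨by
      rw [inf_le_iff]; exact Or.inl hs.le, by rw [le_sup_iff]; exact Or.inr hge⟩
    have hct₀ : t₀ < c := by
      have h1 : min (s : ℝ) t ≤ c := hc.1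
      have h2 : (t₀ : ℝ) < min (s : ℝ) t := lt_min (Subtype.coe_lt_coe.2 hts) (Subtype.coe_lt_coe.2 ht)
      exact Subtype.coe_lt_coe.1 (h2.trans_le h1)
    exact hnoint c hct₀.ne' 1 (by rw [hc1, Int.cast_one])
  -- (3) before `t₀` the lift is negative
  have hbefore_neg : ∀ t : I, t < t₀ → Λ t < 0 := by
    intro t ht
    by_contra hle
    push Not at hle
    obtain ⟨c, hc, hc0⟩ := exists_mem_uIcc_apply_eq hΛ b t (y := 0) ⟨by
      rw [inf_le_iff]; exact Or.inl hb.le, by rw [le_sup_iff]; exact Or.inr hle⟩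
    have hct₀ : c < t₀ := by
      have h1 : (c : ℝ) ≤ max (b : ℝ) t := hc.2
      have h2 : max (b : ℝ) t < t₀ := max_lt (Subtype.coe_lt_coe.2 htb) (Subtype.coe_lt_coe.2 ht)
      exact Subtype.coe_lt_coe.1 (h1.trans_lt h2)
    exact hnoint c hct₀.ne 0 (by rw [hc0, Int.cast_zero])
  -- (4) before `t₀` the lift stays above `-1`
  have hbefore_gt : ∀ t : I, t < t₀ → -1 < Λ t := by
    obtain ⟨s, hts, hs⟩ : ∃ s : I, s < t₀ ∧ -1 < Λ s := by
      have hev : ∀ᶠ t in 𝓝 t₀, -1 < Λ t :=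
        hΛ.continuousAt.eventually (lt_mem_nhds (by rw [h0]; norm_num))
      have ht₀0 : (0 : ℝ) < t₀ := b.2.1.trans_lt (Subtype.coe_lt_coe.2 htb)
      obtain ⟨ε, hε, hball⟩ := Metric.eventually_nhds_iff.1 hev
      set r : ℝ := max ((t₀ : ℝ) - ε / 2) 0 with hr
      have hrI : r ∈ Icc (0 : ℝ) 1 := ⟨le_max_right _ _, max_le (by linarith [t₀.2.2]) zero_le_one⟩
      refine ⟨⟨r, hrI⟩, ?_, hball ?_⟩
      · change r < (t₀ : ℝ)
        exact max_lt (by linarith) ht₀0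
      · rw [Subtype.dist_eq, Real.dist_eq]
        change |r - (t₀ : ℝ)| < ε
        rw [abs_lt]
        constructor
        · have : (t₀ : ℝ) - ε / 2 ≤ r := le_max_left _ _
          linarith
        · have : r < (t₀ : ℝ) := max_lt (by linarith) ht₀0
          linarith
    intro t ht
    by_contra hle
    push Not at hle
    obtain ⟨c, hc, hc1⟩ := exists_mem_uIcc_apply_eq hΛ t s (y := -1) ⟨by
      rw [inf_le_iff]; exact Or.inl hle, by rw [le_sup_iff]; exact Or.inr hs.le⟩
    have hct₀ : c < t₀ := by
      have h1 : (c : ℝ) ≤ max (t : ℝ) s := hc.2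
      have h2 : max (t : ℝ) s < t₀ := max_lt (Subtype.coe_lt_coe.2 ht) (Subtype.coe_lt_coe.2 hts)
      exact Subtype.coe_lt_coe.1 (h1.trans_lt h2)
    exact hnoint c hct₀.ne (-1) (by rw [hc1]; push_cast; ring)
  -- (5) the ends
  have h1t : t₀ < 1 := lt_of_lt_of_le hta (Subtype.coe_le_coe.1 a.2.2)
  have h0t : 0 < t₀ := lt_of_le_of_lt (Subtype.coe_le_coe.1 b.2.1) htb
  have hΛ1 := hafter_pos 1 h1t
  have hΛ1' := hafter_lt 1 h1t
  have hΛ0 := hbefore_neg 0 h0t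
  have hΛ0' := hbefore_gt 0 h0t
  obtain ⟨n, hn⟩ := hends
  have hnlo : (0 : ℝ) < n := by linarith
  have hnhi : (n : ℝ) < 2 := by linarith
  have hn1 : n = 1 := by
    have h1 : 0 < n := by exact_mod_cast hnlo
    have h2 : n < 2 := by exact_mod_cast hnhi
    omega
  rw [hn, hn1, Int.cast_one]

/-- The mirror image of `lift_one_eq_lift_zero_add_one`: a lift which is NEGATIVE somewhere after
its only integer time `t₀` (`Λ t₀ = 0`) and positive somewhere before it descends by one,
`Λ 1 = Λ 0 - 1` (apply the previous statement to `-Λ`).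
[cite: HatcherAT2002, Thm. 1.7 (p. 29) and its proof] -/
theorem lift_one_eq_lift_zero_sub_one (Λ : I → ℝ) (hΛ : Continuous Λ) (t₀ : I) (h0 : Λ t₀ = 0)
    (hint : ∀ t : I, ∀ n : ℤ, Λ t = n → t = t₀)
    (hneg : ∃ t : I, t₀ < t ∧ Λ t < 0) (hpos : ∃ t : I, t < t₀ ∧ 0 < Λ t)
    (hends : ∃ n : ℤ, Λ 1 = Λ 0 + n) : Λ 1 = Λ 0 - 1 := by
  have h := lift_one_eq_lift_zero_add_one (fun t => -Λ t) hΛ.neg t₀ (by simp [h0])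
    (fun t n ht => hint t (-n) (by rw [Int.cast_neg, ← ht, neg_neg]))
    (by obtain ⟨t, ht, hlt⟩ := hneg; exact ⟨t, ht, by linarith⟩)
    (by obtain ⟨t, ht, hlt⟩ := hpos; exact ⟨t, ht, by linarith⟩)
    (by obtain ⟨n, hn⟩ := hends; exact ⟨-n, by rw [hn]; push_cast; ring⟩)
  linarith

end Real

/-! ### The winding number of a single crossing -/

section Crossing

variable {X : Type*} [TopologicalSpace X]

/-- **A global real lift of `θ ∘ γ` normalised at the crossing time.**  For a continuous
`θ : X → ℝ/ℤ`, a loop `γ` at `x` and a time `t₀` with `θ (γ t₀) = 0`, there is a continuous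
`Λ : [0, 1] → ℝ` with `Λ t mod 1 = θ (γ t)` for all `t` and `Λ t₀ = 0` (path lifting for the
covering `ℝ → ℝ/ℤ`, Hatcher Prop. 1.30, shifted by the integer `Λ t₀`).
[cite: HatcherAT2002, Prop. 1.30] -/
theorem exists_lift_eq_zero (θ : C(X, AddCircle (1 : ℝ))) {x : X} (γ : Path x x) (t₀ : I)
    (ht₀ : θ (γ t₀) = 0) :
    ∃ Λ : I → ℝ, Continuous Λ ∧ (∀ t, ((Λ t : ℝ) : AddCircle (1 : ℝ)) = θ (γ t)) ∧ Λ t₀ = 0 := by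
  set cov := AddCircle.isCoveringMap_coe (1 : ℝ)
  obtain ⟨e, he⟩ := QuotientAddGroup.mk_surjective (θ x)
  set δ : C(I, AddCircle (1 : ℝ)) := (γ.map θ.continuous).toContinuousMap with hδ
  have hδ0 : δ 0 = ((e : ℝ) : AddCircle (1 : ℝ)) := by
    change θ (γ 0) = _
    rw [γ.source]
    exact he.symm
  obtain ⟨Γ, hΓ, hΓ0⟩ := cov.exists_path_lifts δ e hδ0
  have hlift : ∀ t, ((Γ t : ℝ) : AddCircle (1 : ℝ)) = θ (γ t) := fun t => congrFun hΓ t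
  -- `Γ t₀` is an integer
  obtain ⟨m, hm⟩ : ∃ m : ℤ, (m : ℝ) = Γ t₀ := by
    have h : ((Γ t₀ : ℝ) : AddCircle (1 : ℝ)) = 0 := by rw [hlift, ht₀]
    rw [AddCircle.coe_eq_zero_iff (1 : ℝ)] at h
    obtain ⟨m, hm⟩ := h
    exact ⟨m, by rw [← hm, zsmul_eq_mul, mul_one]⟩
  refine ⟨fun t => Γ t - m, Γ.continuous.sub continuous_const, fun t => ?_, by simp [hm]⟩
  rw [AddCircle.coe_sub, hlift, (AddCircle.coe_eq_zero_iff (1 : ℝ)).2 ⟨m, by simp⟩, sub_zero]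

/-- Two real lifts of `θ ∘ γ` which agree at `t₀` agree near `t₀` (their difference is a
continuous integer-valued function vanishing at `t₀`, hence `0` wherever it is `< 1/2` in
absolute value). [cite: HatcherAT2002, Prop. 1.30] -/
theorem eventually_eq_of_lifts (θ : C(X, AddCircle (1 : ℝ))) {x : X} (γ : Path x x) (t₀ : I)
    {Λ : I → ℝ} (hΛ : Continuous Λ) (hlift : ∀ t, ((Λ t : ℝ) : AddCircle (1 : ℝ)) = θ (γ t))
    {U : Set I} (hU : U ∈ 𝓝 t₀) {μ : I → ℝ} (hμ : ContinuousOn μ U)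
    (hμlift : ∀ t ∈ U, ((μ t : ℝ) : AddCircle (1 : ℝ)) = θ (γ t)) (h0 : Λ t₀ = μ t₀) :
    ∀ᶠ t in 𝓝 t₀, Λ t = μ t := by
  have hcont : ContinuousAt (fun t => Λ t - μ t) t₀ :=
    hΛ.continuousAt.sub (hμ.continuousAt hU)
  have hsmall : ∀ᶠ t in 𝓝 t₀, |Λ t - μ t| < 1 / 2 := by
    have h := hcont.eventually (Metric.ball_mem_nhds (Λ t₀ - μ t₀) (by norm_num : (0 : ℝ) < 1 / 2))
    filter_upwards [h] with t ht
    rw [Real.dist_eq, h0, sub_self, sub_zero] at ht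
    exact ht
  filter_upwards [hsmall, hU] with t ht htU
  -- `Λ t - μ t` is an integer
  obtain ⟨n, hn⟩ : ∃ n : ℤ, (n : ℝ) = Λ t - μ t := by
    have h : (((Λ t - μ t : ℝ)) : AddCircle (1 : ℝ)) = 0 := by
      rw [AddCircle.coe_sub, hlift, hμlift t htU, sub_self]
    rw [AddCircle.coe_eq_zero_iff (1 : ℝ)] at h
    obtain ⟨n, hn⟩ := h
    exact ⟨n, by rw [← hn, zsmul_eq_mul, mul_one]⟩
  rw [← hn] at ht
  have hn0 : n = 0 := by
    have h1 : |(n : ℝ)| < 1 := ht.trans (by norm_num)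
    have h2 : |n| < 1 := by exact_mod_cast h1
    exact Int.abs_lt_one_iff.1 h2
  rw [hn0, Int.cast_zero] at hn
  linarith

/-- In `[0, 1]`, every neighbourhood of a point `t₀ < 1` contains a point `> t₀`. [folklore] -/
theorem exists_gt_of_mem_nhds_unitInterval {t₀ : I} (ht : (t₀ : ℝ) < 1) {V : Set I}
    (hV : V ∈ 𝓝 t₀) : ∃ t ∈ V, t₀ < t := by
  obtain ⟨ε, hε, hball⟩ := Metric.mem_nhds_iff.1 hV
  set r : ℝ := min ((t₀ : ℝ) + ε / 2) 1 with hr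
  have hrI : r ∈ Icc (0 : ℝ) 1 := ⟨le_min (t₀.2.1.trans (by linarith)) zero_le_one, min_le_right _ _⟩
  have hlt : (t₀ : ℝ) < r := lt_min (by linarith) ht
  refine ⟨⟨r, hrI⟩, hball ?_, Subtype.coe_lt_coe.1 hlt⟩
  rw [Metric.mem_ball, Subtype.dist_eq, Real.dist_eq]
  change |r - (t₀ : ℝ)| < ε
  rw [abs_lt]
  have : r ≤ (t₀ : ℝ) + ε / 2 := min_le_left _ _
  constructor <;> linarith

/-- In `[0, 1]`, every neighbourhood of a point `t₀ > 0` contains a point `< t₀`. [folklore] -/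
theorem exists_lt_of_mem_nhds_unitInterval {t₀ : I} (ht : (0 : ℝ) < t₀) {V : Set I}
    (hV : V ∈ 𝓝 t₀) : ∃ t ∈ V, t < t₀ := by
  obtain ⟨ε, hε, hball⟩ := Metric.mem_nhds_iff.1 hV
  set r : ℝ := max ((t₀ : ℝ) - ε / 2) 0 with hr
  have hrI : r ∈ Icc (0 : ℝ) 1 := ⟨le_max_right _ _, max_le (by linarith [t₀.2.2]) zero_le_one⟩
  have hlt : r < (t₀ : ℝ) := max_lt (by linarith) ht
  refine ⟨⟨r, hrI⟩, hball ?_, Subtype.coe_lt_coe.1 hlt⟩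
  rw [Metric.mem_ball, Subtype.dist_eq, Real.dist_eq]
  change |r - (t₀ : ℝ)| < ε
  rw [abs_lt]
  have : (t₀ : ℝ) - ε / 2 ≤ r := le_max_left _ _
  constructor <;> linarith

/-- If `θ ∘ γ` vanishes only at the time `t₀` then `t₀` is an interior time: `0 < t₀ < 1` (the
two ends of the loop carry the same value `θ x`, which cannot be `0` at both unless `0 = 1`).
[folklore] -/
theorem pos_and_lt_one_of_crossing (θ : C(X, AddCircle (1 : ℝ))) {x : X} (γ : Path x x) (t₀ : I)
    (ht₀ : θ (γ t₀) = 0) (honly : ∀ t, θ (γ t) = 0 → t = t₀) :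
    (0 : ℝ) < t₀ ∧ (t₀ : ℝ) < 1 := by
  have hx : θ x ≠ 0 := by
    intro h
    have h0 : (0 : I) = t₀ := honly 0 (by rw [γ.source]; exact h)
    have h1 : (1 : I) = t₀ := honly 1 (by rw [γ.target]; exact h)
    exact zero_ne_one (h0.trans h1.symm)
  constructor
  · rcases eq_or_lt_of_le t₀.2.1 with h | h
    · exfalso
      apply hx
      have : t₀ = 0 := Subtype.ext h.symm
      rw [← γ.source, ← this]
      exact ht₀
    · exact h
  · rcases eq_or_lt_of_le t₀.2.2 with h | h
    · exfalso
      apply hx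
      have : t₀ = 1 := Subtype.ext h
      rw [← γ.target, ← this]
      exact ht₀
    · exact h

/-- **The winding number of a single positive crossing is `+1`.**  Let `θ : X → ℝ/ℤ` be
continuous and `γ` a loop at `x` which meets the fibre `θ⁻¹(0)` only at the time `t₀`, near
which `θ ∘ γ` has a real lift `μ` with `μ t₀ = 0`, `μ > 0` after `t₀` and `μ < 0` before `t₀`
(on a neighbourhood `U` of `t₀`).  Then the winding homomorphism
`π₁(X, x) → π₁(ℝ/ℤ, θ x) ≅ ℤ` of `θ` takes the value `+1` on `[γ]`.  (With `θ` the collapse of a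
normal coordinate of a two-sided hypersurface this is: a loop crossing the hypersurface once,
positively, has intersection number `+1`.)
[cite: HatcherAT2002, Thm. 1.7 (p. 29) and its proof, Prop. 1.30] -/
theorem wind_eq_ofAdd_one_of_crossing (θ : C(X, AddCircle (1 : ℝ))) {x : X} (γ : Path x x)
    (t₀ : I) (honly : ∀ t, θ (γ t) = 0 → t = t₀) {U : Set I} (hU : U ∈ 𝓝 t₀) {μ : I → ℝ}
    (hμ : ContinuousOn μ U) (hμlift : ∀ t ∈ U, ((μ t : ℝ) : AddCircle (1 : ℝ)) = θ (γ t))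
    (hμ0 : μ t₀ = 0) (hμpos : ∀ t ∈ U, t₀ < t → 0 < μ t) (hμneg : ∀ t ∈ U, t < t₀ → μ t < 0) :
    fundamentalGroupAddCircleEquiv one_ne_zero (θ x)
        (_root_.FundamentalGroup.map θ x
          (_root_.FundamentalGroup.fromPath (Path.Homotopic.Quotient.mk γ))) =
      Multiplicative.ofAdd (1 : ℤ) := by
  have ht₀ : θ (γ t₀) = 0 := by rw [← hμlift t₀ (mem_of_mem_nhds hU), hμ0, QuotientAddGroup.mk_zero]
  obtain ⟨h0t, ht1⟩ := pos_and_lt_one_of_crossing θ γ t₀ ht₀ honly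
  obtain ⟨Λ, hΛ, hlift, hΛ0⟩ := exists_lift_eq_zero θ γ t₀ ht₀
  have hev := eventually_eq_of_lifts θ γ t₀ hΛ hlift hU hμ hμlift (hΛ0.trans hμ0.symm)
  refine wind_fromPath_eq_of_lift θ γ Λ hΛ hlift 1 ?_
  rw [Int.cast_one]
  refine lift_one_eq_lift_zero_add_one Λ hΛ t₀ hΛ0 (fun t n htn => honly t ?_) ?_ ?_ ?_
  · rw [← hlift t, htn]
    exact (AddCircle.coe_eq_zero_iff (1 : ℝ)).2 ⟨n, by simp⟩
  · obtain ⟨t, ht, hlt⟩ := exists_gt_of_mem_nhds_unitInterval ht1 (inter_mem hev hU)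
    exact ⟨t, hlt, by rw [ht.1]; exact hμpos t ht.2 hlt⟩
  · obtain ⟨t, ht, hlt⟩ := exists_lt_of_mem_nhds_unitInterval h0t (inter_mem hev hU)
    exact ⟨t, hlt, by rw [ht.1]; exact hμneg t ht.2 hlt⟩
  · -- the two ends project to the same point `θ x`
    have h : (((Λ 1 - Λ 0 : ℝ)) : AddCircle (1 : ℝ)) = 0 := by
      rw [AddCircle.coe_sub, hlift, hlift, γ.source, γ.target, sub_self]
    rw [AddCircle.coe_eq_zero_iff (1 : ℝ)] at h
    obtain ⟨n, hn⟩ := h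
    exact ⟨n, by rw [zsmul_eq_mul, mul_one] at hn; linarith⟩

/-- **The winding number of a single negative crossing is `-1`** (the mirror image of
`wind_eq_ofAdd_one_of_crossing`: the local lift is negative after `t₀` and positive before).
[cite: HatcherAT2002, Thm. 1.7 (p. 29) and its proof, Prop. 1.30] -/
theorem wind_eq_ofAdd_neg_one_of_crossing (θ : C(X, AddCircle (1 : ℝ))) {x : X} (γ : Path x x)
    (t₀ : I) (honly : ∀ t, θ (γ t) = 0 → t = t₀) {U : Set I} (hU : U ∈ 𝓝 t₀) {μ : I → ℝ}
    (hμ : ContinuousOn μ U) (hμlift : ∀ t ∈ U, ((μ t : ℝ) : AddCircle (1 : ℝ)) = θ (γ t))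
    (hμ0 : μ t₀ = 0) (hμneg : ∀ t ∈ U, t₀ < t → μ t < 0) (hμpos : ∀ t ∈ U, t < t₀ → 0 < μ t) :
    fundamentalGroupAddCircleEquiv one_ne_zero (θ x)
        (_root_.FundamentalGroup.map θ x
          (_root_.FundamentalGroup.fromPath (Path.Homotopic.Quotient.mk γ))) =
      Multiplicative.ofAdd (-1 : ℤ) := by
  have ht₀ : θ (γ t₀) = 0 := by rw [← hμlift t₀ (mem_of_mem_nhds hU), hμ0, QuotientAddGroup.mk_zero]
  obtain ⟨h0t, ht1⟩ := pos_and_lt_one_of_crossing θ γ t₀ ht₀ honly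
  obtain ⟨Λ, hΛ, hlift, hΛ0⟩ := exists_lift_eq_zero θ γ t₀ ht₀
  have hev := eventually_eq_of_lifts θ γ t₀ hΛ hlift hU hμ hμlift (hΛ0.trans hμ0.symm)
  refine wind_fromPath_eq_of_lift θ γ Λ hΛ hlift (-1) ?_
  rw [Int.cast_neg, Int.cast_one, ← sub_eq_add_neg]
  refine lift_one_eq_lift_zero_sub_one Λ hΛ t₀ hΛ0 (fun t n htn => honly t ?_) ?_ ?_ ?_
  · rw [← hlift t, htn]
    exact (AddCircle.coe_eq_zero_iff (1 : ℝ)).2 ⟨n, by simp⟩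
  · obtain ⟨t, ht, hlt⟩ := exists_gt_of_mem_nhds_unitInterval ht1 (inter_mem hev hU)
    exact ⟨t, hlt, by rw [ht.1]; exact hμneg t ht.2 hlt⟩
  · obtain ⟨t, ht, hlt⟩ := exists_lt_of_mem_nhds_unitInterval h0t (inter_mem hev hU)
    exact ⟨t, hlt, by rw [ht.1]; exact hμpos t ht.2 hlt⟩
  · have h : (((Λ 1 - Λ 0 : ℝ)) : AddCircle (1 : ℝ)) = 0 := by
      rw [AddCircle.coe_sub, hlift, hlift, γ.source, γ.target, sub_self]
    rw [AddCircle.coe_eq_zero_iff (1 : ℝ)] at h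
    obtain ⟨n, hn⟩ := h
    exact ⟨n, by rw [zsmul_eq_mul, mul_one] at hn; linarith⟩

/-- **A loop crossing the fibre once has non-trivial winding number** (`+1` or `-1` according
to the direction of the crossing; here the local lift is only assumed to have opposite strict
signs on the two sides of `t₀`, in either order).
[cite: HatcherAT2002, Thm. 1.7 (p. 29) and its proof] -/
theorem wind_ne_one_of_crossing (θ : C(X, AddCircle (1 : ℝ))) {x : X} (γ : Path x x)
    (t₀ : I) (honly : ∀ t, θ (γ t) = 0 → t = t₀) {U : Set I} (hU : U ∈ 𝓝 t₀) {μ : I → ℝ}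
    (hμ : ContinuousOn μ U) (hμlift : ∀ t ∈ U, ((μ t : ℝ) : AddCircle (1 : ℝ)) = θ (γ t))
    (hμ0 : μ t₀ = 0)
    (hsides : (∀ t ∈ U, t₀ < t → 0 < μ t) ∧ (∀ t ∈ U, t < t₀ → μ t < 0) ∨
      (∀ t ∈ U, t₀ < t → μ t < 0) ∧ (∀ t ∈ U, t < t₀ → 0 < μ t)) :
    fundamentalGroupAddCircleEquiv one_ne_zero (θ x)
        (_root_.FundamentalGroup.map θ x
          (_root_.FundamentalGroup.fromPath (Path.Homotopic.Quotient.mk γ))) ≠ 1 := by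
  rcases hsides with ⟨hpos, hneg⟩ | ⟨hneg, hpos⟩
  · rw [wind_eq_ofAdd_one_of_crossing θ γ t₀ honly hU hμ hμlift hμ0 hpos hneg]
    decide
  · rw [wind_eq_ofAdd_neg_one_of_crossing θ γ t₀ honly hU hμ hμlift hμ0 hneg hpos]
    decide

/-- **Hence the winding homomorphism of `θ` is not the trivial homomorphism**, and the class
`[γ]` is non-trivial in `π₁(X, x)`. [cite: HatcherAT2002, Thm. 1.7 (p. 29) and its proof] -/
theorem windingHom_ne_one_of_crossing (θ : C(X, AddCircle (1 : ℝ))) {x : X} (γ : Path x x)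
    (t₀ : I) (honly : ∀ t, θ (γ t) = 0 → t = t₀) {U : Set I} (hU : U ∈ 𝓝 t₀) {μ : I → ℝ}
    (hμ : ContinuousOn μ U) (hμlift : ∀ t ∈ U, ((μ t : ℝ) : AddCircle (1 : ℝ)) = θ (γ t))
    (hμ0 : μ t₀ = 0)
    (hsides : (∀ t ∈ U, t₀ < t → 0 < μ t) ∧ (∀ t ∈ U, t < t₀ → μ t < 0) ∨
      (∀ t ∈ U, t₀ < t → μ t < 0) ∧ (∀ t ∈ U, t < t₀ → 0 < μ t)) :
    ((fundamentalGroupAddCircleEquiv one_ne_zero (θ x)).toMonoidHom.comp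
        (_root_.FundamentalGroup.map θ x) ≠ 1) ∧
      _root_.FundamentalGroup.fromPath (Path.Homotopic.Quotient.mk γ) ≠ (1 : FundamentalGroup X x) := by
  have h := wind_ne_one_of_crossing θ γ t₀ honly hU hμ hμlift hμ0 hsides
  refine ⟨fun hw => h ?_, fun hγ => h ?_⟩
  · have := DFunLike.congr_fun hw (_root_.FundamentalGroup.fromPath (Path.Homotopic.Quotient.mk γ))
    simpa using this
  · rw [hγ, map_one, map_one]

end Crossing

end Literature.AlgebraicTopology.FundamentalGroup

end
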